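import Literature.NumberTheory.Sieve.HeathBrownCubicTypeIIClassIICount
import HarnessLib

/-!
# Heath-Brown's Lemma 3.10, §12 pp. 73–74: there are `O(N⁵)` Class II hypercubes

Support for the proof of **Lemma 3.10** of D. R. Heath-Brown, *Primes represented by `x³ + 2y³`*,
Acta Math. 186 (2001), §12 pp. 73–74 (quoted in `HeathBrownCubicTypeIIClassIICount`): "Each Class II
hypercube contains a point for which one of the equations `N(β_i) = V` or `2V`, `β_i³ = N(β_i)ε₀^{∓3/2}`,
`p_i(β₁,β₂) = XD` or `XD(1+η)`, `q_i(β₁,β₂) = XD` or `XD(1+η)` holds. … the vertices of the hypercube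
satisfy an equation of the form `F_i(n₁,…,n₆) = H_i' + O(N²)` … there are `O(N⁵)` Class II hypercubes."

We PROVE this for the classes of `HeathBrownCubicTypeIILocalise` (Class II = neither Class I nor Class 0;
our window `T < σ₁(β) ≤ ET` replaces `β³ = N(β)ε₀^{±3/2}` and is linear):

* homogeneity of the forms on the corner `s𝐧` (`ell_smul_aux`, `normForm_smul`, `pR_smul`) and the Lipschitz
  step from a point of the hypercube to its corner;
* `NearBdry` — the disjunction of the sixteen "vertex near a boundary" conditions in grid units
  (`|ell(𝐧) − h| ≤ 8`, `|N(𝐧) − h| ≤ 1248N²` with `|N(𝐧)| ≥ N³/2`, `|p_i − h|, |q_i − h| ≤ 8000N²` with the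
  same size condition), and **`nearBdry_of_classII`**: a hypercube which is neither of Class I nor of
  Class 0 satisfies `NearBdry` (`N ≥ 1248`);
* **`card_classII_le`**: `#{(𝐧,𝐧') ∈ Nrange² : Class II} ≤ 3.4·10¹⁰ (6N+3)⁵` (the sixteen counts of
  `HeathBrownCubicTypeIIClassIICount`).

## References

* D. R. Heath-Brown, *Primes represented by `x³ + 2y³`*, Acta Math. 186 (2001), §12 pp. 73–74.
  [cite: HeathBrownActa2001, §12 pp. 73–74]

## Mathlib / tree search

Tree: `HeathBrownCubicTypeIIClassIICount` (the counts), `HeathBrownCubicTypeIILocalise` (`ClassI`, `Class0`,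
`GoodB`, `RDR`, `Drange`, `realCell`, `Nrange`), `HeathBrownCubicTypeIIForms` (`abs_pR_sub_le`, `adjR_bounds`),
`HeathBrownCubicCubeSums` (`abs_normForm_sub_le`), `HeathBrownCubicWindow` (`abs_coord_le_of_inWindow`).
-/

noncomputable section

open Finset NumberField

namespace Literature.NumberTheory.Sieve.CubicSieve

open LFunctions.CubeRootTwoField CubicPrimes

/-! ### Homogeneity and the corner -/

/-- `ell(s𝐩) = s·ell(𝐩)`. [folklore] -/
private theorem ell_smul_aux (s : ℝ) (p : ℝ × ℝ × ℝ) : ell (s • p) = s * ell p := by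
  simp only [ell, Prod.smul_fst, Prod.smul_snd, smul_eq_mul]; ring

/-- `N(s𝐩) = s³ N(𝐩)`. [folklore] -/
theorem normForm_smul (s : ℝ) (p : ℝ × ℝ × ℝ) : normForm (s • p) = s ^ 3 * normForm p := by
  simp only [normForm, Prod.smul_fst, Prod.smul_snd, smul_eq_mul]; ring

/-- The four forms are homogeneous cubic: `p₁(s𝐚, s𝐛) = s³ p₁(𝐚, 𝐛)`, etc. [folklore] -/
theorem pR_smul (s : ℝ) (a b : ℝ × ℝ × ℝ) :
    p1R (s • a) (s • b) = s ^ 3 * p1R a b ∧ q1R (s • a) (s • b) = s ^ 3 * q1R a b ∧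
      p2R (s • a) (s • b) = s ^ 3 * p2R a b ∧ q2R (s • a) (s • b) = s ^ 3 * q2R a b := by
  simp only [p1R, q1R, p2R, q2R, dotR, gradPR, gradQR, adjAR, adjBR, adjCR, Prod.smul_fst, Prod.smul_snd,
    smul_eq_mul]
  refine ⟨by ring, by ring, by ring, by ring⟩

/-- The corner `s𝐧` of the hypercube `C(𝐧)` as `s • castVec 𝐧`, a point of the closed hypercube. [folklore] -/
theorem smul_castVec_mem_realCell {s : ℝ} (hs : 0 ≤ s) (n : ℤ × ℤ × ℤ) : s • castVec n ∈ realCell s n := by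
  have := corner_mem_realCell hs n
  simpa [castVec, Prod.smul_fst, Prod.smul_snd, smul_eq_mul] using this

/-- Two points of the same closed hypercube differ by `≤ s` in each coordinate. [folklore] -/
theorem abs_sub_le_of_mem_realCell {s : ℝ} {n : ℤ × ℤ × ℤ} {x y : ℝ × ℝ × ℝ} (hx : x ∈ realCell s n)
    (hy : y ∈ realCell s n) : |x.1 - y.1| ≤ s ∧ |x.2.1 - y.2.1| ≤ s ∧ |x.2.2 - y.2.2| ≤ s := by
  obtain ⟨⟨a1, a2⟩, ⟨b1, b2⟩, ⟨c1, c2⟩⟩ := hx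
  obtain ⟨⟨a1', a2'⟩, ⟨b1', b2'⟩, ⟨c1', c2'⟩⟩ := hy
  refine ⟨abs_le.mpr ⟨by linarith, by linarith⟩, abs_le.mpr ⟨by linarith, by linarith⟩,
    abs_le.mpr ⟨by linarith, by linarith⟩⟩

/-- Coordinates of a point of the hypercube containing a good point are `≤ 3T + s` in modulus. [folklore] -/
theorem abs_coord_le_of_near {s T M : ℝ} {x y : ℝ × ℝ × ℝ} (hy : |y.1| ≤ M ∧ |y.2.1| ≤ M ∧ |y.2.2| ≤ M)
    (hd : |x.1 - y.1| ≤ s ∧ |x.2.1 - y.2.1| ≤ s ∧ |x.2.2 - y.2.2| ≤ s) (hT : M + s ≤ T) :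
    |x.1| ≤ T ∧ |x.2.1| ≤ T ∧ |x.2.2| ≤ T := by
  obtain ⟨h1, h2, h3⟩ := hy
  obtain ⟨d1, d2, d3⟩ := hd
  refine ⟨?_, ?_, ?_⟩
  · calc |x.1| = |(x.1 - y.1) + y.1| := by ring_nf
      _ ≤ |x.1 - y.1| + |y.1| := abs_add_le _ _
      _ ≤ T := by linarith
  · calc |x.2.1| = |(x.2.1 - y.2.1) + y.2.1| := by ring_nf
      _ ≤ |x.2.1 - y.2.1| + |y.2.1| := abs_add_le _ _
      _ ≤ T := by linarith
  · calc |x.2.2| = |(x.2.2 - y.2.2) + y.2.2| := by ring_nf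
      _ ≤ |x.2.2 - y.2.2| + |y.2.2| := abs_add_le _ _
      _ ≤ T := by linarith

/-- `|ell x − ell y| ≤ 4s` for coordinates differing by `≤ s`. [folklore] -/
theorem abs_ell_sub_le {s : ℝ} {x y : ℝ × ℝ × ℝ} (hd : |x.1 - y.1| ≤ s ∧ |x.2.1 - y.2.1| ≤ s ∧ |x.2.2 - y.2.2| ≤ s) :
    |ell x - ell y| ≤ 4 * s := by
  obtain ⟨d1, d2, d3⟩ := hd
  have hρ := rho_pos; have hρ' := rho_lt
  have hs : 0 ≤ s := (abs_nonneg _).trans d1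
  have e : ell x - ell y = (x.1 - y.1) + rho * (x.2.1 - y.2.1) + rho ^ 2 * (x.2.2 - y.2.2) := by
    simp only [ell]; ring
  rw [e]
  calc |(x.1 - y.1) + rho * (x.2.1 - y.2.1) + rho ^ 2 * (x.2.2 - y.2.2)|
      ≤ |x.1 - y.1| + |rho * (x.2.1 - y.2.1)| + |rho ^ 2 * (x.2.2 - y.2.2)| := abs_add_three _ _ _
    _ = |x.1 - y.1| + rho * |x.2.1 - y.2.1| + rho ^ 2 * |x.2.2 - y.2.2| := by
        rw [abs_mul, abs_mul, abs_of_pos hρ, abs_of_pos (by positivity : (0 : ℝ) < rho ^ 2)]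
    _ ≤ s + rho * s + rho ^ 2 * s := by gcongr
    _ = (1 + rho + rho ^ 2) * s := by ring
    _ ≤ 4 * s := by
        have h4 : 1 + rho + rho ^ 2 ≤ 4 := by nlinarith
        exact mul_le_mul_of_nonneg_right h4 hs

/-- The gradient bound: `|p₁(x₁, x₂)| ≤ 54 M³` when all coordinates are `≤ M` (for the `D`-range). [folklore] -/
theorem abs_p1R_le {x₁ x₂ : ℝ × ℝ × ℝ} {M : ℝ} (h₁ : |x₁.1| ≤ M ∧ |x₁.2.1| ≤ M ∧ |x₁.2.2| ≤ M)
    (h₂ : |x₂.1| ≤ M ∧ |x₂.2.1| ≤ M ∧ |x₂.2.2| ≤ M) : |p1R x₁ x₂| ≤ 54 * M ^ 3 := by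
  have hM : 0 ≤ M := (abs_nonneg _).trans h₁.1
  obtain ⟨⟨bA, bB, bC⟩, -⟩ := adjR_bounds (δ := 0) h₁ h₁ ⟨by simp, by simp, by simp⟩
  obtain ⟨c1, c2, c3⟩ := h₂
  simp only [p1R, dotR, gradPR]
  calc |adjBR x₁ * x₂.1 + adjAR x₁ * x₂.2.1 + 2 * adjCR x₁ * x₂.2.2|
      ≤ |adjBR x₁ * x₂.1| + |adjAR x₁ * x₂.2.1| + |2 * adjCR x₁ * x₂.2.2| := abs_add_three _ _ _
    _ = |adjBR x₁| * |x₂.1| + |adjAR x₁| * |x₂.2.1| + 2 * |adjCR x₁| * |x₂.2.2| := by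
        rw [abs_mul, abs_mul, abs_mul, abs_mul, abs_two]
    _ ≤ 3 * M ^ 2 * M + 3 * M ^ 2 * M + 2 * (3 * M ^ 2) * M := by gcongr
    _ ≤ 54 * M ^ 3 := by nlinarith [pow_nonneg hM 3]

/-! ### The near-boundary conditions in grid units -/

/-- **The sixteen "vertex near a boundary" conditions** for the index pair `(𝐧, 𝐧')`, `A = e^{t/N}`,
`s = T/N`: window thresholds `T/s`, `ET/s` for `𝐧` or `𝐧'`; norm thresholds `V/s³ = N³`, `2N³` with the
size condition `|N| ≥ N³/2`; `p_i, q_i` thresholds `XA/s³`, `X(1+η)A/s³` with the size condition on the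
relevant index. [cite: HeathBrownActa2001, §12 p. 73] -/
def NearBdry (X η T : ℝ) (N t : ℕ) (nn : (ℤ × ℤ × ℤ) × (ℤ × ℤ × ℤ)) : Prop :=
  let s : ℝ := T / N
  let A : ℝ := Real.exp ((t : ℝ) / N)
  let big : ℤ × ℤ × ℤ → Prop := fun n => (N : ℝ) ^ 3 / 2 ≤ |(normFormZ n : ℝ)|
  (|ell (castVec nn.1) - T / s| ≤ 8 ∨ |ell (castVec nn.1) - unitE * T / s| ≤ 8 ∨
    |ell (castVec nn.2) - T / s| ≤ 8 ∨ |ell (castVec nn.2) - unitE * T / s| ≤ 8) ∨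
  ((|(normFormZ nn.1 : ℝ) - (N : ℝ) ^ 3| ≤ 1248 * (N : ℝ) ^ 2 ∧ big nn.1) ∨
    (|(normFormZ nn.1 : ℝ) - 2 * (N : ℝ) ^ 3| ≤ 1248 * (N : ℝ) ^ 2 ∧ big nn.1) ∨
    (|(normFormZ nn.2 : ℝ) - (N : ℝ) ^ 3| ≤ 1248 * (N : ℝ) ^ 2 ∧ big nn.2) ∨
    (|(normFormZ nn.2 : ℝ) - 2 * (N : ℝ) ^ 3| ≤ 1248 * (N : ℝ) ^ 2 ∧ big nn.2)) ∨
  ((|(p1Z nn.1 nn.2 : ℝ) - X * A / s ^ 3| ≤ 8000 * (N : ℝ) ^ 2 ∧ big nn.1) ∨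
    (|(p1Z nn.1 nn.2 : ℝ) - X * (1 + η) * A / s ^ 3| ≤ 8000 * (N : ℝ) ^ 2 ∧ big nn.1) ∨
    (|(q1Z nn.1 nn.2 : ℝ) - X * A / s ^ 3| ≤ 8000 * (N : ℝ) ^ 2 ∧ big nn.1) ∨
    (|(q1Z nn.1 nn.2 : ℝ) - X * (1 + η) * A / s ^ 3| ≤ 8000 * (N : ℝ) ^ 2 ∧ big nn.1)) ∨
  ((|(p2Z nn.1 nn.2 : ℝ) - X * A / s ^ 3| ≤ 8000 * (N : ℝ) ^ 2 ∧ big nn.2) ∨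
    (|(p2Z nn.1 nn.2 : ℝ) - X * (1 + η) * A / s ^ 3| ≤ 8000 * (N : ℝ) ^ 2 ∧ big nn.2) ∨
    (|(q2Z nn.1 nn.2 : ℝ) - X * A / s ^ 3| ≤ 8000 * (N : ℝ) ^ 2 ∧ big nn.2) ∨
    (|(q2Z nn.1 nn.2 : ℝ) - X * (1 + η) * A / s ^ 3| ≤ 8000 * (N : ℝ) ^ 2 ∧ big nn.2))

/-! ### Grid conversions -/

/-- From `|u − h| ≤ w s` for `u = s³ z` to `|z − h/s³| ≤ w/s²`. [folklore] -/
theorem grid_cubic {s z h w : ℝ} (hs : 0 < s) (hu : |s ^ 3 * z - h| ≤ w * s) : |z - h / s ^ 3| ≤ w / s ^ 2 := by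
  have hs3 : 0 < s ^ 3 := by positivity
  have e : z - h / s ^ 3 = (s ^ 3 * z - h) / s ^ 3 := by field_simp
  rw [e, abs_div, abs_of_pos hs3, div_le_div_iff₀ hs3 (by positivity)]
  calc |s ^ 3 * z - h| * s ^ 2 ≤ w * s * s ^ 2 := by gcongr
    _ = w * s ^ 3 := by ring

/-- From `|u − h| ≤ w s` for `u = s z` to `|z − h/s| ≤ w`. [folklore] -/
theorem grid_linear {s z h w : ℝ} (hs : 0 < s) (hu : |s * z - h| ≤ w * s) : |z - h / s| ≤ w := by
  have e : z - h / s = (s * z - h) / s := by field_simp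
  rw [e, abs_div, abs_of_pos hs, div_le_iff₀ hs]
  exact hu

/-- From `c ≤ |s³ z|` to `c/s³ ≤ |z|`. [folklore] -/
theorem grid_big {s z c : ℝ} (hs : 0 < s) (hu : c ≤ |s ^ 3 * z|) : c / s ^ 3 ≤ |z| := by
  have hs3 : 0 < s ^ 3 := by positivity
  rw [abs_mul, abs_of_pos hs3] at hu
  rw [div_le_iff₀ hs3]; linarith

/-! ### Class II hypercubes have a vertex near a boundary -/

set_option maxHeartbeats 1000000 in
/-- **A hypercube which is neither of Class I nor of Class 0 has its corner near one of the sixteen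
boundaries** (`N ≥ 1248`, so that the norm stays `≥ V/2` across a hypercube). The printed argument:
"Each Class II hypercube contains a point for which one of the equations … holds … we may use (12.1) and
(11.7) to replace `H_i = XD` or `XD(1+η)` by `H_i + O(V/N)` … the vertices of the hypercube satisfy
`F_i(n₁,…,n₆) = H_i' + O(N²)`." [cite: HeathBrownActa2001, §12 pp. 73–74] -/
theorem nearBdry_of_classII {X η T V : ℝ} (hX : 0 < X) (hη0 : 0 ≤ η) (hη1 : η ≤ 1) (hT : 0 < T)
    (hTV : T ^ 3 = V) {N : ℕ} (hN : 1248 ≤ N) {t : ℕ} {n n' : ℤ × ℤ × ℤ}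
    (h0 : ¬ Class0 X η T V N t n n') (hI : ¬ ClassI X η T V N t n n') : NearBdry X η T N t (n, n') := by
  -- unpack the two witnesses
  simp only [Class0, not_forall, not_not, exists_prop] at h0
  obtain ⟨P₁, hP₁, P₂, hP₂, D, hD, gP₁, gP₂, hR⟩ := h0
  simp only [ClassI, not_forall, exists_prop] at hI
  obtain ⟨Q₁, hQ₁, Q₂, hQ₂, hbad⟩ := hI
  -- parameters
  have hNR : (1248 : ℝ) ≤ N := by exact_mod_cast hN
  have hN0 : (0 : ℝ) < N := by linarith
  set s : ℝ := T / N with hs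
  have hs0 : 0 < s := by positivity
  have hsN : s * N = T := by rw [hs]; field_simp
  have hsT : 1248 * s ≤ T := by
    rw [hs, mul_div_assoc', div_le_iff₀ hN0]
    have := mul_le_mul_of_nonneg_left hNR hT.le
    linarith
  have hsT1 : s ≤ T := by linarith
  have hV : 0 < V := by rw [← hTV]; positivity
  have hT2s : V = T ^ 2 * (s * N) := by rw [hsN, ← hTV]; ring
  set A : ℝ := Real.exp ((t : ℝ) / N) with hA
  have hApos : 0 < A := Real.exp_pos _
  set κ : ℝ × ℝ × ℝ := s • castVec n with hκ
  set κ' : ℝ × ℝ × ℝ := s • castVec n' with hκ'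
  have hκmem : κ ∈ realCell s n := smul_castVec_mem_realCell hs0.le n
  have hκ'mem : κ' ∈ realCell s n' := smul_castVec_mem_realCell hs0.le n'
  -- sizes
  have szP₁ : |P₁.1| ≤ 3 * T ∧ |P₁.2.1| ≤ 3 * T ∧ |P₁.2.2| ≤ 3 * T :=
    abs_coord_le_of_inWindow hT hTV gP₁.1.1 gP₁.1.2 gP₁.2.2
  have szP₂ : |P₂.1| ≤ 3 * T ∧ |P₂.2.1| ≤ 3 * T ∧ |P₂.2.2| ≤ 3 * T :=
    abs_coord_le_of_inWindow hT hTV gP₂.1.1 gP₂.1.2 gP₂.2.2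
  have dPQ₁ := abs_sub_le_of_mem_realCell hP₁ hQ₁
  have dPQ₂ := abs_sub_le_of_mem_realCell hP₂ hQ₂
  have dPκ₁ := abs_sub_le_of_mem_realCell hP₁ hκmem
  have dPκ₂ := abs_sub_le_of_mem_realCell hP₂ hκ'mem
  have dQP₁ := abs_sub_le_of_mem_realCell hQ₁ hP₁
  have dQP₂ := abs_sub_le_of_mem_realCell hQ₂ hP₂
  have dκP₁ := abs_sub_le_of_mem_realCell hκmem hP₁
  have dκP₂ := abs_sub_le_of_mem_realCell hκ'mem hP₂
  have h34 : 3 * T + s ≤ 4 * T := by linarith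
  have szQ₁ := abs_coord_le_of_near szP₁ dQP₁ h34
  have szQ₂ := abs_coord_le_of_near szP₂ dQP₂ h34
  have szκ := abs_coord_le_of_near szP₁ dκP₁ h34
  have szκ' := abs_coord_le_of_near szP₂ dκP₂ h34
  have szP₁' : |P₁.1| ≤ 4 * T ∧ |P₁.2.1| ≤ 4 * T ∧ |P₁.2.2| ≤ 4 * T :=
    ⟨szP₁.1.trans (by linarith), szP₁.2.1.trans (by linarith), szP₁.2.2.trans (by linarith)⟩
  have szP₂' : |P₂.1| ≤ 4 * T ∧ |P₂.2.1| ≤ 4 * T ∧ |P₂.2.2| ≤ 4 * T :=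
    ⟨szP₂.1.trans (by linarith), szP₂.2.1.trans (by linarith), szP₂.2.2.trans (by linarith)⟩
  -- Lipschitz
  have LN_PQ₁ := abs_normForm_sub_le szP₁' szQ₁ dPQ₁      -- `≤ 39 (4T)² s`
  have LN_Pκ₁ := abs_normForm_sub_le szP₁' szκ dPκ₁
  have LN_PQ₂ := abs_normForm_sub_le szP₂' szQ₂ dPQ₂
  have LN_Pκ₂ := abs_normForm_sub_le szP₂' szκ' dPκ₂
  have Le_PQ₁ := abs_ell_sub_le dPQ₁
  have Le_Pκ₁ := abs_ell_sub_le dPκ₁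
  have Le_PQ₂ := abs_ell_sub_le dPQ₂
  have Le_Pκ₂ := abs_ell_sub_le dPκ₂
  have LF_PQ := abs_pR_sub_le szP₁' szP₂' szQ₁ szQ₂ dPQ₁ dPQ₂   -- `≤ 54 (4T)² s`
  have LF_Pκ := abs_pR_sub_le szP₁' szP₂' szκ szκ' dPκ₁ dPκ₂
  have e624 : (39 : ℝ) * (4 * T) ^ 2 * s = 624 * T ^ 2 * s := by ring
  have e864 : (54 : ℝ) * (4 * T) ^ 2 * s = 864 * T ^ 2 * s := by ring
  rw [e624] at LN_PQ₁ LN_Pκ₁ LN_PQ₂ LN_Pκ₂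
  rw [e864] at LF_PQ LF_Pκ
  -- the `D`-range
  have hD1 : A ≤ D := hD.1
  have hexp := exp_inv_le (lt_of_lt_of_le (by norm_num) hN)
  have hexp_split : Real.exp (((t : ℝ) + 1) / N) = A * Real.exp (1 / (N : ℝ)) := by
    rw [hA, ← Real.exp_add]; congr 1; field_simp
  have hDA : ∀ D' ∈ Drange N t, A ≤ D' ∧ D' ≤ A + A * (2 / N) := by
    intro D' hD'
    obtain ⟨h1, h2⟩ := hD'
    refine ⟨h1, ?_⟩
    calc D' ≤ Real.exp (((t : ℝ) + 1) / N) := h2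
      _ = A * Real.exp (1 / (N : ℝ)) := hexp_split
      _ ≤ A * (1 + 2 / N) := by gcongr
      _ = A + A * (2 / N) := by ring
  have hT2s0 : 0 ≤ T ^ 2 * s := by positivity
  have hXD : X * A < 1458 * V := by
    have h1 := hR.1.1
    have h2 := abs_p1R_le szP₁ szP₂
    have h3 : p1R P₁ P₂ ≤ 54 * (3 * T) ^ 3 := (le_abs_self _).trans h2
    have h4 : X * A ≤ X * D := mul_le_mul_of_nonneg_left hD1 hX.le
    have e : (54 : ℝ) * (3 * T) ^ 3 = 1458 * V := by rw [← hTV]; ring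
    linarith
  -- spread of the thresholds over the `D`-range: `X |D' - A| ≤ 2916 T² s`
  have hspread : ∀ D' ∈ Drange N t, 0 ≤ X * D' - X * A ∧ X * D' - X * A ≤ 2916 * T ^ 2 * s := by
    intro D' hD'
    obtain ⟨a1, a2⟩ := hDA D' hD'
    have b1 := mul_le_mul_of_nonneg_left a1 hX.le
    have b2 := mul_le_mul_of_nonneg_left a2 hX.le
    refine ⟨by linarith, ?_⟩
    have : X * D' - X * A ≤ X * A * 2 / N := by
      have e : X * (A + A * (2 / (N : ℝ))) = X * A + X * A * 2 / N := by ring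
      linarith
    refine this.trans ?_
    rw [div_le_iff₀ hN0]
    have e : 2916 * T ^ 2 * s * (N : ℝ) = 2916 * V := by rw [hT2s]; ring
    rw [e]; linarith
  have hspreadD := hspread D hD
  -- grid identities at the corner
  have gell : ell κ = s * ell (castVec n) := by rw [hκ, ell_smul_aux]
  have gell' : ell κ' = s * ell (castVec n') := by rw [hκ', ell_smul_aux]
  have gN : normForm κ = s ^ 3 * (normFormZ n : ℝ) := by rw [hκ, normForm_smul, normForm_castVec]
  have gN' : normForm κ' = s ^ 3 * (normFormZ n' : ℝ) := by rw [hκ', normForm_smul, normForm_castVec]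
  obtain ⟨gp1, gq1, gp2, gq2⟩ := pR_smul s (castVec n) (castVec n')
  rw [p1R_castVec] at gp1; rw [q1R_castVec] at gq1; rw [p2R_castVec] at gp2; rw [q2R_castVec] at gq2
  rw [← hκ, ← hκ'] at gp1 gq1 gp2 gq2
  have eN2 : (1248 : ℝ) * T ^ 2 / s ^ 2 = 1248 * (N : ℝ) ^ 2 := by
    rw [show T = s * N from hsN.symm]; field_simp
  have eN2' : (8000 : ℝ) * T ^ 2 / s ^ 2 = 8000 * (N : ℝ) ^ 2 := by
    rw [show T = s * N from hsN.symm]; field_simp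
  have eN3 : V / s ^ 3 = (N : ℝ) ^ 3 := by
    rw [← hTV, show T = s * N from hsN.symm]; field_simp
  have eN3' : 2 * V / s ^ 3 = 2 * (N : ℝ) ^ 3 := by
    rw [← hTV, show T = s * N from hsN.symm]; field_simp
  have eN3h : V / 2 / s ^ 3 = (N : ℝ) ^ 3 / 2 := by
    rw [← hTV, show T = s * N from hsN.symm]; field_simp
  -- the norm at the corners stays `≥ V/2`
  have half : 624 * T ^ 2 * s ≤ V / 2 := by
    have := mul_le_mul_of_nonneg_left hNR hT2s0
    rw [hT2s]; linarith
  have bigκ : V / 2 ≤ |normForm κ| := by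
    have h1 : V < normForm P₁ := gP₁.2.1
    have h2 := (abs_le.mp LN_Pκ₁).2
    have : V / 2 ≤ normForm κ := by linarith
    exact this.trans (le_abs_self _)
  have bigκ' : V / 2 ≤ |normForm κ'| := by
    have h1 : V < normForm P₂ := gP₂.2.1
    have h2 := (abs_le.mp LN_Pκ₂).2
    have : V / 2 ≤ normForm κ' := by linarith
    exact this.trans (le_abs_self _)
  have bign : (N : ℝ) ^ 3 / 2 ≤ |(normFormZ n : ℝ)| := by
    rw [← eN3h]; exact grid_big hs0 (by rw [← gN]; exact bigκ)
  have bign' : (N : ℝ) ^ 3 / 2 ≤ |(normFormZ n' : ℝ)| := by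
    rw [← eN3h]; exact grid_big hs0 (by rw [← gN']; exact bigκ')
  -- a small helper: from the two-sided information to the corner
  have corner : ∀ (fP fQ fκ θ L₁ L₂ : ℝ), |fP - fQ| ≤ L₁ → |fP - fκ| ≤ L₂ →
      ((fQ ≤ θ ∧ θ < fP) ∨ (fP ≤ θ ∧ θ < fQ)) → |fκ - θ| ≤ L₁ + L₂ := by
    intro fP fQ fκ θ L₁ L₂ h1 h2 h3
    rw [abs_le] at h1 h2 ⊢
    rcases h3 with ⟨a, b⟩ | ⟨a, b⟩ <;> constructor <;> linarith
  -- now the case analysis on the failure at `Q`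
  unfold NearBdry
  dsimp only
  rw [← hs, ← hA]
  by_cases g1 : GoodB T V Q₁
  · by_cases g2 : GoodB T V Q₂
    · -- some `RDR` inequality fails at some `D'`
      have hnot : ∃ D' ∈ Drange N t, ¬ RDR X η D' Q₁ Q₂ := by
        by_contra hall; push Not at hall; exact hbad ⟨g1, g2, hall⟩
      obtain ⟨D', hD', hfail⟩ := hnot
      obtain ⟨sp0, sp1⟩ := hspread D' hD'
      obtain ⟨spD0, spD1⟩ := hspreadD
      obtain ⟨⟨r1, r2⟩, ⟨r3, r4⟩, ⟨r5, r6⟩, ⟨r7, r8⟩⟩ := hR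
      obtain ⟨f1, f2, f3, f4⟩ := LF_PQ
      obtain ⟨k1, k2, k3, k4⟩ := LF_Pκ
      have hη2 : X * (1 + η) * D - X * (1 + η) * A ≤ 2 * (2916 * T ^ 2 * s) := by
        have h := mul_le_mul (by linarith : 1 + η ≤ 2) spD1 spD0 (by norm_num)
        have e : X * (1 + η) * D - X * (1 + η) * A = (1 + η) * (X * D - X * A) := by ring
        linarith
      have hη2' : X * (1 + η) * D' - X * (1 + η) * A ≥ 0 := by
        have h := mul_nonneg (by linarith : (0 : ℝ) ≤ 1 + η) sp0
        have e : X * (1 + η) * D' - X * (1 + η) * A = (1 + η) * (X * D' - X * A) := by ring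
        linarith
      simp only [RDR, not_and_or, not_lt, not_le] at hfail
      -- generic conclusion for a form value
      have lower : ∀ (fP fQ fκ : ℝ), |fP - fQ| ≤ 864 * T ^ 2 * s → |fP - fκ| ≤ 864 * T ^ 2 * s →
          X * D < fP → fQ ≤ X * D' → |fκ - X * A| ≤ 8000 * T ^ 2 * s := by
        intro fP fQ fκ h1 h2 h3 h4
        rw [abs_le] at h1 h2 ⊢
        constructor <;> linarith
      have upper : ∀ (fP fQ fκ : ℝ), |fP - fQ| ≤ 864 * T ^ 2 * s → |fP - fκ| ≤ 864 * T ^ 2 * s →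
          fP ≤ X * (1 + η) * D → X * (1 + η) * D' < fQ → |fκ - X * (1 + η) * A| ≤ 8000 * T ^ 2 * s := by
        intro fP fQ fκ h1 h2 h3 h4
        rw [abs_le] at h1 h2 ⊢
        constructor <;> linarith
      have toGrid : ∀ (z θ : ℝ), |s ^ 3 * z - θ| ≤ 8000 * T ^ 2 * s → |z - θ / s ^ 3| ≤ 8000 * (N : ℝ) ^ 2 := by
        intro z θ h; rw [← eN2']; exact grid_cubic hs0 h
      rcases hfail with (c1 | c2) | (c3 | c4) | (c5 | c6) | (c7 | c8)
      · -- `p₁(Q) ≤ XD'`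
        have := lower _ _ _ f1 k1 r1 c1
        rw [gp1] at this
        exact Or.inr (Or.inr (Or.inl (Or.inl ⟨toGrid _ _ this, bign⟩)))
      · have := upper _ _ _ f1 k1 r2 c2
        rw [gp1] at this
        exact Or.inr (Or.inr (Or.inl (Or.inr (Or.inl ⟨toGrid _ _ this, bign⟩))))
      · have := lower _ _ _ f2 k2 r3 c3
        rw [gq1] at this
        exact Or.inr (Or.inr (Or.inl (Or.inr (Or.inr (Or.inl ⟨toGrid _ _ this, bign⟩)))))
      · have := upper _ _ _ f2 k2 r4 c4
        rw [gq1] at this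
        exact Or.inr (Or.inr (Or.inl (Or.inr (Or.inr (Or.inr ⟨toGrid _ _ this, bign⟩)))))
      · have := lower _ _ _ f3 k3 r5 c5
        rw [gp2] at this
        exact Or.inr (Or.inr (Or.inr (Or.inl ⟨toGrid _ _ this, bign'⟩)))
      · have := upper _ _ _ f3 k3 r6 c6
        rw [gp2] at this
        exact Or.inr (Or.inr (Or.inr (Or.inr (Or.inl ⟨toGrid _ _ this, bign'⟩))))
      · have := lower _ _ _ f4 k4 r7 c7
        rw [gq2] at this
        exact Or.inr (Or.inr (Or.inr (Or.inr (Or.inr (Or.inl ⟨toGrid _ _ this, bign'⟩)))))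
      · have := upper _ _ _ f4 k4 r8 c8
        rw [gq2] at this
        exact Or.inr (Or.inr (Or.inr (Or.inr (Or.inr (Or.inr ⟨toGrid _ _ this, bign'⟩)))))
    · -- `Q₂` not good
      simp only [GoodB, not_and_or, not_lt, not_le] at g2
      rcases g2 with (a1 | a2) | (a3 | a4)
      · have := corner _ _ _ T _ _ Le_PQ₂ Le_Pκ₂ (Or.inl ⟨a1, gP₂.1.1⟩)
        rw [gell'] at this
        refine Or.inl (Or.inr (Or.inr (Or.inl ?_)))
        exact grid_linear (w := 8) hs0 (by linarith)
      · have := corner _ _ _ (unitE * T) _ _ Le_PQ₂ Le_Pκ₂ (Or.inr ⟨gP₂.1.2, a2⟩)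
        rw [gell'] at this
        refine Or.inl (Or.inr (Or.inr (Or.inr ?_)))
        exact grid_linear (w := 8) hs0 (by linarith)
      · have := corner _ _ _ V _ _ LN_PQ₂ LN_Pκ₂ (Or.inl ⟨a3, gP₂.2.1⟩)
        rw [gN'] at this
        refine Or.inr (Or.inl (Or.inr (Or.inr (Or.inl ⟨?_, bign'⟩))))
        rw [← eN3, ← eN2]; exact grid_cubic hs0 (by linarith)
      · have := corner _ _ _ (2 * V) _ _ LN_PQ₂ LN_Pκ₂ (Or.inr ⟨gP₂.2.2, a4⟩)
        rw [gN'] at this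
        refine Or.inr (Or.inl (Or.inr (Or.inr (Or.inr ⟨?_, bign'⟩))))
        rw [← eN3', ← eN2]; exact grid_cubic hs0 (by linarith)
  · -- `Q₁` not good
    simp only [GoodB, not_and_or, not_lt, not_le] at g1
    rcases g1 with (a1 | a2) | (a3 | a4)
    · have := corner _ _ _ T _ _ Le_PQ₁ Le_Pκ₁ (Or.inl ⟨a1, gP₁.1.1⟩)
      rw [gell] at this
      refine Or.inl (Or.inl ?_)
      exact grid_linear (w := 8) hs0 (by linarith)
    · have := corner _ _ _ (unitE * T) _ _ Le_PQ₁ Le_Pκ₁ (Or.inr ⟨gP₁.1.2, a2⟩)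
      rw [gell] at this
      refine Or.inl (Or.inr (Or.inl ?_))
      exact grid_linear (w := 8) hs0 (by linarith)
    · have := corner _ _ _ V _ _ LN_PQ₁ LN_Pκ₁ (Or.inl ⟨a3, gP₁.2.1⟩)
      rw [gN] at this
      refine Or.inr (Or.inl (Or.inl ⟨?_, bign⟩))
      rw [← eN3, ← eN2]; exact grid_cubic hs0 (by linarith)
    · have := corner _ _ _ (2 * V) _ _ LN_PQ₁ LN_Pκ₁ (Or.inr ⟨gP₁.2.2, a4⟩)
      rw [gN] at this
      refine Or.inr (Or.inl (Or.inr (Or.inl ⟨?_, bign⟩)))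
      rw [← eN3', ← eN2]; exact grid_cubic hs0 (by linarith)

/-! ### The count -/

/-- `p₂(𝐚, 𝐛) = −p₁(𝐛, 𝐚)` and `q₂(𝐚, 𝐛) = −q₁(𝐛, 𝐚)`. [cite: HeathBrownActa2001, §12 p. 72] -/
theorem p2Z_eq_neg (a b : ℤ × ℤ × ℤ) : p2Z a b = -p1Z b a ∧ q2Z a b = -q1Z b a := by
  rw [p2Z_eq, p1Z_eq, q2Z_eq, q1Z_eq, neg_neg]; exact ⟨rfl, rfl⟩

open scoped Classical in
/-- **There are `O(N⁵)` Class II hypercubes**: for `N ≥ 1248` and every cell `t`,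
`#{(𝐧, 𝐧') ∈ Nrange² : neither Class I nor Class 0} ≤ 3.4·10¹⁰ (6N+3)⁵`. [cite: HeathBrownActa2001, §12 p. 74] -/
theorem card_classII_le {X η T V : ℝ} (hX : 0 < X) (hη0 : 0 ≤ η) (hη1 : η ≤ 1) (hT : 0 < T)
    (hTV : T ^ 3 = V) {N : ℕ} (hN : 1248 ≤ N) (t : ℕ) :
    (#((Nrange N ×ˢ Nrange N).filter fun nn =>
        ¬ ClassI X η T V N t nn.1 nn.2 ∧ ¬ Class0 X η T V N t nn.1 nn.2) : ℝ) ≤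
      34000000000 * (6 * (N : ℝ) + 3) ^ 5 := by
  classical
  have hN1 : 1 ≤ N := le_trans (by norm_num) hN
  set F := Nrange N ×ˢ Nrange N with hF
  set s : ℝ := T / N with hs
  set A : ℝ := Real.exp ((t : ℝ) / N) with hA
  set w8 : ℝ := 8000 * (N : ℝ) ^ 2 with hw8
  set w1 : ℝ := 1248 * (N : ℝ) ^ 2 with hw1
  set big : ℤ × ℤ × ℤ → Prop := fun n => (N : ℝ) ^ 3 / 2 ≤ |(normFormZ n : ℝ)| with hbig
  set B : ℝ := (6 * (N : ℝ) + 3) ^ 5 with hB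
  have hB0 : 0 ≤ B := by positivity
  -- step 1: Class II ⟹ near a boundary
  have h1 : #(F.filter fun nn => ¬ ClassI X η T V N t nn.1 nn.2 ∧ ¬ Class0 X η T V N t nn.1 nn.2) ≤
      #(F.filter fun nn => NearBdry X η T N t nn) :=
    card_le_card fun nn hnn => by
      rw [mem_filter] at hnn ⊢
      exact ⟨hnn.1, nearBdry_of_classII hX hη0 hη1 hT hTV hN hnn.2.2 hnn.2.1⟩
  -- the sixteen individual bounds
  have cE : ∀ h : ℝ, (#(F.filter fun nn => |ell (castVec nn.1) - h| ≤ 8) : ℝ) ≤ 12 * B := fun h => card_ell_near_le N h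
  have cE' : ∀ h : ℝ, (#(F.filter fun nn => |ell (castVec nn.2) - h| ≤ 8) : ℝ) ≤ 12 * B := by
    intro h
    have := card_swap_filter (Nrange N) (fun x : (ℤ × ℤ × ℤ) × (ℤ × ℤ × ℤ) => |ell (castVec x.1) - h| ≤ 8)
    rw [← hF] at this
    rw [show (F.filter fun nn => |ell (castVec nn.2) - h| ≤ 8) =
      F.filter (fun nn => (fun x : (ℤ × ℤ × ℤ) × (ℤ × ℤ × ℤ) => |ell (castVec x.1) - h| ≤ 8) nn.swap) from rfl, this]
    exact cE h
  have cN : ∀ h : ℝ, (#(F.filter fun nn => |(normFormZ nn.1 : ℝ) - h| ≤ w1 ∧ big nn.1) : ℝ) ≤ 2100000000 * B :=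
    fun h => card_norm_near_le hN1 h
  have cN' : ∀ h : ℝ, (#(F.filter fun nn => |(normFormZ nn.2 : ℝ) - h| ≤ w1 ∧ big nn.2) : ℝ) ≤ 2100000000 * B := by
    intro h
    have := card_swap_filter (Nrange N)
      (fun x : (ℤ × ℤ × ℤ) × (ℤ × ℤ × ℤ) => |(normFormZ x.1 : ℝ) - h| ≤ w1 ∧ big x.1)
    rw [← hF] at this
    rw [show (F.filter fun nn => |(normFormZ nn.2 : ℝ) - h| ≤ w1 ∧ big nn.2) =
      F.filter (fun nn => (fun x : (ℤ × ℤ × ℤ) × (ℤ × ℤ × ℤ) => |(normFormZ x.1 : ℝ) - h| ≤ w1 ∧ big x.1) nn.swap)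
      from rfl, this]
    exact cN h
  have cP1 : ∀ h : ℝ, (#(F.filter fun nn => |(p1Z nn.1 nn.2 : ℝ) - h| ≤ w8 ∧ big nn.1) : ℝ) ≤ 640001 * B :=
    fun h => card_p1_near_le hN1 h
  have cQ1 : ∀ h : ℝ, (#(F.filter fun nn => |(q1Z nn.1 nn.2 : ℝ) - h| ≤ w8 ∧ big nn.1) : ℝ) ≤ 640001 * B :=
    fun h => card_q1_near_le hN1 h
  have cP2 : ∀ h : ℝ, (#(F.filter fun nn => |(p2Z nn.1 nn.2 : ℝ) - h| ≤ w8 ∧ big nn.2) : ℝ) ≤ 640001 * B := by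
    intro h
    have hcongr : (F.filter fun nn => |(p2Z nn.1 nn.2 : ℝ) - h| ≤ w8 ∧ big nn.2) =
        F.filter (fun nn => (fun x : (ℤ × ℤ × ℤ) × (ℤ × ℤ × ℤ) => |(p1Z x.1 x.2 : ℝ) - -h| ≤ w8 ∧ big x.1) nn.swap) := by
      refine filter_congr fun nn _ => ?_
      simp only [Prod.fst_swap, Prod.snd_swap, (p2Z_eq_neg nn.1 nn.2).1, Int.cast_neg]
      rw [show (-(p1Z nn.2 nn.1 : ℝ) - h) = -((p1Z nn.2 nn.1 : ℝ) - -h) by ring, abs_neg]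
    have := card_swap_filter (Nrange N)
      (fun x : (ℤ × ℤ × ℤ) × (ℤ × ℤ × ℤ) => |(p1Z x.1 x.2 : ℝ) - -h| ≤ w8 ∧ big x.1)
    rw [← hF] at this
    rw [hcongr, this]
    exact cP1 (-h)
  have cQ2 : ∀ h : ℝ, (#(F.filter fun nn => |(q2Z nn.1 nn.2 : ℝ) - h| ≤ w8 ∧ big nn.2) : ℝ) ≤ 640001 * B := by
    intro h
    have hcongr : (F.filter fun nn => |(q2Z nn.1 nn.2 : ℝ) - h| ≤ w8 ∧ big nn.2) =
        F.filter (fun nn => (fun x : (ℤ × ℤ × ℤ) × (ℤ × ℤ × ℤ) => |(q1Z x.1 x.2 : ℝ) - -h| ≤ w8 ∧ big x.1) nn.swap) := by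
      refine filter_congr fun nn _ => ?_
      simp only [Prod.fst_swap, Prod.snd_swap, (p2Z_eq_neg nn.1 nn.2).2, Int.cast_neg]
      rw [show (-(q1Z nn.2 nn.1 : ℝ) - h) = -((q1Z nn.2 nn.1 : ℝ) - -h) by ring, abs_neg]
    have := card_swap_filter (Nrange N)
      (fun x : (ℤ × ℤ × ℤ) × (ℤ × ℤ × ℤ) => |(q1Z x.1 x.2 : ℝ) - -h| ≤ w8 ∧ big x.1)
    rw [← hF] at this
    rw [hcongr, this]
    exact cQ1 (-h)
  -- count by indicators
  have hcount : (#(F.filter fun nn => NearBdry X η T N t nn) : ℝ) ≤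
      ∑ x ∈ F, ((if |ell (castVec x.1) - T / s| ≤ 8 then (1 : ℝ) else 0) +
        (if |ell (castVec x.1) - unitE * T / s| ≤ 8 then (1 : ℝ) else 0) +
        (if |ell (castVec x.2) - T / s| ≤ 8 then (1 : ℝ) else 0) +
        (if |ell (castVec x.2) - unitE * T / s| ≤ 8 then (1 : ℝ) else 0) +
        (if |(normFormZ x.1 : ℝ) - (N : ℝ) ^ 3| ≤ w1 ∧ big x.1 then (1 : ℝ) else 0) +
        (if |(normFormZ x.1 : ℝ) - 2 * (N : ℝ) ^ 3| ≤ w1 ∧ big x.1 then (1 : ℝ) else 0) +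
        (if |(normFormZ x.2 : ℝ) - (N : ℝ) ^ 3| ≤ w1 ∧ big x.2 then (1 : ℝ) else 0) +
        (if |(normFormZ x.2 : ℝ) - 2 * (N : ℝ) ^ 3| ≤ w1 ∧ big x.2 then (1 : ℝ) else 0) +
        (if |(p1Z x.1 x.2 : ℝ) - X * A / s ^ 3| ≤ w8 ∧ big x.1 then (1 : ℝ) else 0) +
        (if |(p1Z x.1 x.2 : ℝ) - X * (1 + η) * A / s ^ 3| ≤ w8 ∧ big x.1 then (1 : ℝ) else 0) +
        (if |(q1Z x.1 x.2 : ℝ) - X * A / s ^ 3| ≤ w8 ∧ big x.1 then (1 : ℝ) else 0) +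
        (if |(q1Z x.1 x.2 : ℝ) - X * (1 + η) * A / s ^ 3| ≤ w8 ∧ big x.1 then (1 : ℝ) else 0) +
        (if |(p2Z x.1 x.2 : ℝ) - X * A / s ^ 3| ≤ w8 ∧ big x.2 then (1 : ℝ) else 0) +
        (if |(p2Z x.1 x.2 : ℝ) - X * (1 + η) * A / s ^ 3| ≤ w8 ∧ big x.2 then (1 : ℝ) else 0) +
        (if |(q2Z x.1 x.2 : ℝ) - X * A / s ^ 3| ≤ w8 ∧ big x.2 then (1 : ℝ) else 0) +
        (if |(q2Z x.1 x.2 : ℝ) - X * (1 + η) * A / s ^ 3| ≤ w8 ∧ big x.2 then (1 : ℝ) else 0)) := by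
    rw [natCast_card_filter]
    refine sum_le_sum fun x _ => ?_
    have nn : ∀ (P : Prop) [Decidable P], (0 : ℝ) ≤ if P then 1 else 0 := by
      intro P _; split_ifs <;> norm_num
    have n1 := nn (|ell (castVec x.1) - T / s| ≤ 8)
    have n2 := nn (|ell (castVec x.1) - unitE * T / s| ≤ 8)
    have n3 := nn (|ell (castVec x.2) - T / s| ≤ 8)
    have n4 := nn (|ell (castVec x.2) - unitE * T / s| ≤ 8)
    have n5 := nn (|(normFormZ x.1 : ℝ) - (N : ℝ) ^ 3| ≤ w1 ∧ big x.1)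
    have n6 := nn (|(normFormZ x.1 : ℝ) - 2 * (N : ℝ) ^ 3| ≤ w1 ∧ big x.1)
    have n7 := nn (|(normFormZ x.2 : ℝ) - (N : ℝ) ^ 3| ≤ w1 ∧ big x.2)
    have n8 := nn (|(normFormZ x.2 : ℝ) - 2 * (N : ℝ) ^ 3| ≤ w1 ∧ big x.2)
    have n9 := nn (|(p1Z x.1 x.2 : ℝ) - X * A / s ^ 3| ≤ w8 ∧ big x.1)
    have n10 := nn (|(p1Z x.1 x.2 : ℝ) - X * (1 + η) * A / s ^ 3| ≤ w8 ∧ big x.1)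
    have n11 := nn (|(q1Z x.1 x.2 : ℝ) - X * A / s ^ 3| ≤ w8 ∧ big x.1)
    have n12 := nn (|(q1Z x.1 x.2 : ℝ) - X * (1 + η) * A / s ^ 3| ≤ w8 ∧ big x.1)
    have n13 := nn (|(p2Z x.1 x.2 : ℝ) - X * A / s ^ 3| ≤ w8 ∧ big x.2)
    have n14 := nn (|(p2Z x.1 x.2 : ℝ) - X * (1 + η) * A / s ^ 3| ≤ w8 ∧ big x.2)
    have n15 := nn (|(q2Z x.1 x.2 : ℝ) - X * A / s ^ 3| ≤ w8 ∧ big x.2)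
    have n16 := nn (|(q2Z x.1 x.2 : ℝ) - X * (1 + η) * A / s ^ 3| ≤ w8 ∧ big x.2)
    by_cases hNBx : NearBdry X η T N t x
    · rw [if_pos hNBx]
      have hx := hNBx
      unfold NearBdry at hx
      dsimp only at hx
      rw [← hs, ← hA] at hx
      rcases hx with (e1 | e2 | e3 | e4) | (m1 | m2 | m3 | m4) | (p1 | p2 | q1 | q2) | (p3 | p4 | q3 | q4)
      · have : (if |ell (castVec x.1) - T / s| ≤ 8 then (1 : ℝ) else 0) = 1 := if_pos e1; linarith
      · have : (if |ell (castVec x.1) - unitE * T / s| ≤ 8 then (1 : ℝ) else 0) = 1 := if_pos e2; linarith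
      · have : (if |ell (castVec x.2) - T / s| ≤ 8 then (1 : ℝ) else 0) = 1 := if_pos e3; linarith
      · have : (if |ell (castVec x.2) - unitE * T / s| ≤ 8 then (1 : ℝ) else 0) = 1 := if_pos e4; linarith
      · have : (if |(normFormZ x.1 : ℝ) - (N : ℝ) ^ 3| ≤ w1 ∧ big x.1 then (1 : ℝ) else 0) = 1 := if_pos m1; linarith
      · have : (if |(normFormZ x.1 : ℝ) - 2 * (N : ℝ) ^ 3| ≤ w1 ∧ big x.1 then (1 : ℝ) else 0) = 1 := if_pos m2; linarith
      · have : (if |(normFormZ x.2 : ℝ) - (N : ℝ) ^ 3| ≤ w1 ∧ big x.2 then (1 : ℝ) else 0) = 1 := if_pos m3; linarith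
      · have : (if |(normFormZ x.2 : ℝ) - 2 * (N : ℝ) ^ 3| ≤ w1 ∧ big x.2 then (1 : ℝ) else 0) = 1 := if_pos m4; linarith
      · have : (if |(p1Z x.1 x.2 : ℝ) - X * A / s ^ 3| ≤ w8 ∧ big x.1 then (1 : ℝ) else 0) = 1 := if_pos p1; linarith
      · have : (if |(p1Z x.1 x.2 : ℝ) - X * (1 + η) * A / s ^ 3| ≤ w8 ∧ big x.1 then (1 : ℝ) else 0) = 1 := if_pos p2; linarith
      · have : (if |(q1Z x.1 x.2 : ℝ) - X * A / s ^ 3| ≤ w8 ∧ big x.1 then (1 : ℝ) else 0) = 1 := if_pos q1; linarith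
      · have : (if |(q1Z x.1 x.2 : ℝ) - X * (1 + η) * A / s ^ 3| ≤ w8 ∧ big x.1 then (1 : ℝ) else 0) = 1 := if_pos q2; linarith
      · have : (if |(p2Z x.1 x.2 : ℝ) - X * A / s ^ 3| ≤ w8 ∧ big x.2 then (1 : ℝ) else 0) = 1 := if_pos p3; linarith
      · have : (if |(p2Z x.1 x.2 : ℝ) - X * (1 + η) * A / s ^ 3| ≤ w8 ∧ big x.2 then (1 : ℝ) else 0) = 1 := if_pos p4; linarith
      · have : (if |(q2Z x.1 x.2 : ℝ) - X * A / s ^ 3| ≤ w8 ∧ big x.2 then (1 : ℝ) else 0) = 1 := if_pos q3; linarith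
      · have : (if |(q2Z x.1 x.2 : ℝ) - X * (1 + η) * A / s ^ 3| ≤ w8 ∧ big x.2 then (1 : ℝ) else 0) = 1 := if_pos q4; linarith
    · rw [if_neg hNBx]; linarith
  have b1 := cE (T / s); have b2 := cE (unitE * T / s); have b3 := cE' (T / s); have b4 := cE' (unitE * T / s)
  have b5 := cN ((N : ℝ) ^ 3); have b6 := cN (2 * (N : ℝ) ^ 3); have b7 := cN' ((N : ℝ) ^ 3); have b8 := cN' (2 * (N : ℝ) ^ 3)
  have b9 := cP1 (X * A / s ^ 3); have b10 := cP1 (X * (1 + η) * A / s ^ 3)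
  have b11 := cQ1 (X * A / s ^ 3); have b12 := cQ1 (X * (1 + η) * A / s ^ 3)
  have b13 := cP2 (X * A / s ^ 3); have b14 := cP2 (X * (1 + η) * A / s ^ 3)
  have b15 := cQ2 (X * A / s ^ 3); have b16 := cQ2 (X * (1 + η) * A / s ^ 3)
  simp only [sum_add_distrib, sum_boole] at hcount
  calc (#(F.filter fun nn => ¬ ClassI X η T V N t nn.1 nn.2 ∧ ¬ Class0 X η T V N t nn.1 nn.2) : ℝ)
      ≤ #(F.filter fun nn => NearBdry X η T N t nn) := by exact_mod_cast h1
    _ ≤ 34000000000 * B := by linarith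

end Literature.NumberTheory.Sieve.CubicSieve

end
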